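import Summits.ValiantsHypothesis.ValiantsHypothesis.Theorems.LacunarySymmetroidMatrixDescartesGraftToolkit
import Summits.ValiantsHypothesis.ValiantsHypothesis.Theorems.LacunarySymmetroidMatrixDescartesStubPerturbRankOne

/-!
# `MatrixDescartes` census — THE DEEP-END LAW: a rank-one letter grafted at a far exponent is worth
# `1 + (far alternations of the adjugate form)`, for every format

HONEST FRAMING.  Cell `val-V1-extremal` (engine seat val-v1x-eng-6 g4, the `m = 2` row lineage), crux
`Theses.LacunarySymmetroid.MatrixDescartes` (stmt-ValiantsHypothesis-18050).  LOWER-bound / construction mathematics in census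
(CONJECTURE-A) currency: it proves NOTHING about the crux (an UPPER-bound statement at fat formats), nothing about `DoorA26` / `DoorA34`,
nothing about `VP ≠ VNP`.  No definitions.  Helper mode (`--supports stmt-ValiantsHypothesis-18050`).

THE LAW (`exists_alternating_rankOne_graft`, row form `not_posRootLawAt_rankOne_graft`).  Let `P(y) = ∑ l, y^(d l) • S l` be a real
symmetric `K`-letter `m × m` pencil with an alternation certificate `0 < τ 0 < ⋯ < τ N` (`det P (τ j) ≠ 0`, consecutive signs opposite),
let `v : Fin m → ℝ`, and suppose the ADJUGATE FORM `u(y) = v ⬝ᵥ adj (P y) *ᵥ v` (a real polynomial in `y`; for `m = 2` it is the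
compression `wᵀ P(y) w`, `w = J v`) has its own alternation certificate `σ 0 < ⋯ < σ M` BEYOND the first one (`τ N < σ 0`).  Then for a
suitable far exponent `D` (larger than every `d l`) and a real `μ`, the `(K+1)`-letter real symmetric pencil `P(y) + μ y^D • v vᵀ` alternates
along ALL of `τ 0 < ⋯ < τ N < σ 0 < ⋯ < σ M`: **`N + M + 1` alternations, hence `¬ PosRootLawAt m (K+1) (N + M)`** — one new rank-one
letter is worth `1 + M` (the junction sign is free because the sign of `μ` is free).  Mechanism: the matrix determinant lemma with the
adjugate (tree `Perturb.det_add_vecMulVec`) makes the grafted determinant AFFINE in the graft,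
`det (P y + μ y^D • v vᵀ) = det P y + μ y^D · u(y)`; with `μ = ε / t⋆^D` for a separator `τ N < t⋆ < σ 0` the graft dies at the old
points (`(τ j / t⋆)^D → 0`) and dominates at the new ones (`(t⋆ / σ j)^D → 0` after division), so finitely many eventual sign statements
give one `D`; `ε = −(det P (τ N)) · u(σ 0)` makes the junction alternate.  This is the exact mechanism behind the census's «deep ends»
(m = 2 record rows `T14`, `G18`, `C22`, `GRAFT25`: shallow core + one far near-rank-one letter per end, worth `2 + γ` each — `γ + 1 = M`
is the number of far roots of the compressed pencil `wᵀ P w`; the seat's `endscan` instrument tabulates `M` over the census); the tree's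
GRAFT LAW (`Graft.exists_alternating_succ`, `+m` with a full-rank diagonal letter) and TAIL GRAFT (`+1` at the same format) are the
neighbouring statements.  [folklore] throughout (matrix determinant lemma, dominant geometric rate, intermediate value theorem downstream).
-/

-- `Summit.ValiantsHypothesis.ValiantsHypothesis.…` repeats a component by the D-0017 layout
-- (single-conjunct summit), which the `dupNamespace` linter flags; the name is mandated.
set_option linter.dupNamespace false

namespace Summit.ValiantsHypothesis.ValiantsHypothesis.Theorems.LacunarySymmetroidMatrixDescartes.Census.DeepEnd

open Matrix Finset Filter Topology
open scoped BigOperators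
open Summit.ValiantsHypothesis.ValiantsHypothesis.Theorems.LacunarySymmetroidMatrixDescartes.Census.Graft
open Summit.ValiantsHypothesis.ValiantsHypothesis.Theorems.LacunarySymmetroidMatrixDescartes.Perturb
open Summit.ValiantsHypothesis.ValiantsHypothesis.Theorems.MatrixDescartes.Negative (PosRootLawAt)

/-! ### Bookkeeping: the grafted pencil and its determinant -/

/-- Value of the pencil with one appended letter: old block plus `y^D • L`. [folklore] -/
theorem snoc_eval {m K : ℕ} (d : Fin K → ℕ) (S : Fin K → Matrix (Fin m) (Fin m) ℝ) (D : ℕ)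
    (L : Matrix (Fin m) (Fin m) ℝ) (y : ℝ) :
    ∑ l, y ^ (Fin.snoc d D : Fin (K + 1) → ℕ) l • (Fin.snoc S L : Fin (K + 1) → Matrix (Fin m) (Fin m) ℝ) l
      = (∑ l, y ^ d l • S l) + y ^ D • L := by
  rw [Fin.sum_univ_castSucc]
  simp only [Fin.snoc_castSucc, Fin.snoc_last]

/-- The rank-one letter `v vᵀ` is symmetric. [folklore] -/
theorem isSymm_vecMulVec_self {m : ℕ} (v : Fin m → ℝ) : (vecMulVec v v).IsSymm := by
  unfold Matrix.IsSymm
  ext i j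
  simp [vecMulVec_apply, mul_comm]

/-- Matrix determinant lemma, scaled rank-one form: `det (A + c • v vᵀ) = det A + c · (v ⬝ᵥ adj A *ᵥ v)`. [folklore] -/
theorem det_add_smul_vecMulVec {m : ℕ} (A : Matrix (Fin m) (Fin m) ℝ) (c : ℝ) (v : Fin m → ℝ) :
    (A + c • vecMulVec v v).det = A.det + c * (v ⬝ᵥ (A.adjugate *ᵥ v)) := by
  have h := det_add_vecMulVec A (c • v) v
  have hv : vecMulVec (c • v) v = c • vecMulVec v v := by
    ext i j
    simp [vecMulVec_apply, mul_assoc]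
  rw [hv] at h
  rw [h, mulVec_smul, dotProduct_smul, smul_eq_mul]

/-- Strictly increasing real sequences glue: `τ` then `σ`, when `τ last < σ 0`. [folklore] -/
theorem strictMono_glue {N M : ℕ} (τ : Fin (N + 1) → ℝ) (σ : Fin (M + 1) → ℝ) (hτ : StrictMono τ)
    (hσ : StrictMono σ) (hsep : τ (Fin.last N) < σ 0) :
    StrictMono (fun j : Fin (N + M + 2) =>
      if h : (j : ℕ) ≤ N then τ ⟨j, Nat.lt_succ_of_le h⟩ else σ ⟨(j : ℕ) - (N + 1), by omega⟩) := by
  intro i j hij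
  have hij' : (i : ℕ) < (j : ℕ) := Fin.lt_def.mp hij
  by_cases hi : (i : ℕ) ≤ N
  · by_cases hj : (j : ℕ) ≤ N
    · simp only [dif_pos hi, dif_pos hj]
      exact hτ (Fin.mk_lt_mk.mpr hij')
    · simp only [dif_pos hi, dif_neg hj]
      have h1 : τ ⟨i, Nat.lt_succ_of_le hi⟩ ≤ τ (Fin.last N) := hτ.monotone (Fin.mk_le_mk.mpr hi)
      have h2 : σ 0 ≤ σ ⟨(j : ℕ) - (N + 1), by omega⟩ := hσ.monotone (Fin.zero_le _)
      linarith
  · have hj : ¬ (j : ℕ) ≤ N := by omega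
    simp only [dif_neg hi, dif_neg hj]
    exact hσ (Fin.mk_lt_mk.mpr (by omega))

/-! ### The deep-end law -/

/-- **THE DEEP-END LAW (all formats).**  See the module docstring.  From an alternation certificate `τ` of the `K`-letter real symmetric
pencil `P` and an alternation certificate `σ` of the adjugate form `v ⬝ᵥ adj(P y) *ᵥ v` lying beyond it (`τ N < σ 0`), a far exponent
`D > d l` and a real `μ` such that `P(y) + y^D • (μ • v vᵀ)` alternates along the glued points: `N + M + 1` alternations with `K + 1`
letters. [folklore] -/
theorem exists_alternating_rankOne_graft {m K N M : ℕ} (d : Fin K → ℕ) (S : Fin K → Matrix (Fin m) (Fin m) ℝ)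
    (τ : Fin (N + 1) → ℝ) (hτ : StrictMono τ) (hτpos : ∀ j, 0 < τ j)
    (hne : ∀ j, (∑ l, τ j ^ d l • S l).det ≠ 0)
    (halt : ∀ j : Fin N, (∑ l, τ j.castSucc ^ d l • S l).det * (∑ l, τ j.succ ^ d l • S l).det < 0)
    (v : Fin m → ℝ) (σ : Fin (M + 1) → ℝ) (hσ : StrictMono σ) (hsep : τ (Fin.last N) < σ 0)
    (hune : ∀ j, v ⬝ᵥ ((∑ l, σ j ^ d l • S l).adjugate *ᵥ v) ≠ 0)
    (hualt : ∀ j : Fin M, (v ⬝ᵥ ((∑ l, σ j.castSucc ^ d l • S l).adjugate *ᵥ v)) *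
      (v ⬝ᵥ ((∑ l, σ j.succ ^ d l • S l).adjugate *ᵥ v)) < 0) :
    ∃ (D : ℕ) (μ : ℝ), (∀ l, d l < D) ∧
      let τ' : Fin (N + M + 2) → ℝ := fun j =>
        if h : (j : ℕ) ≤ N then τ ⟨j, Nat.lt_succ_of_le h⟩ else σ ⟨(j : ℕ) - (N + 1), by omega⟩
      StrictMono τ' ∧ (∀ j, 0 < τ' j) ∧
      (∀ j, (∑ l, τ' j ^ (Fin.snoc d D : Fin (K + 1) → ℕ) l •
          (Fin.snoc S (μ • vecMulVec v v) : Fin (K + 1) → Matrix (Fin m) (Fin m) ℝ) l).det ≠ 0) ∧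
      ∀ j : Fin (N + M + 1),
        (∑ l, τ' j.castSucc ^ (Fin.snoc d D : Fin (K + 1) → ℕ) l •
            (Fin.snoc S (μ • vecMulVec v v) : Fin (K + 1) → Matrix (Fin m) (Fin m) ℝ) l).det *
        (∑ l, τ' j.succ ^ (Fin.snoc d D : Fin (K + 1) → ℕ) l •
            (Fin.snoc S (μ • vecMulVec v v) : Fin (K + 1) → Matrix (Fin m) (Fin m) ℝ) l).det < 0 := by
  classical
  -- abbreviations
  set P : ℝ → Matrix (Fin m) (Fin m) ℝ := fun y => ∑ l, y ^ d l • S l with hP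
  set u : ℝ → ℝ := fun y => v ⬝ᵥ ((P y).adjugate *ᵥ v) with hu
  have hσpos : ∀ j, 0 < σ j := fun j =>
    lt_of_lt_of_le ((hτpos _).trans hsep) (hσ.monotone (Fin.zero_le j))
  -- separator and junction sign
  obtain ⟨tstar, ht1, ht2⟩ : ∃ t : ℝ, τ (Fin.last N) < t ∧ t < σ 0 := exists_between hsep
  have htpos : 0 < tstar := (hτpos _).trans ht1
  set ε : ℝ := -((P (τ (Fin.last N))).det * u (σ 0)) with hε
  have hεne : ε ≠ 0 := by
    rw [hε]; exact neg_ne_zero.mpr (mul_ne_zero (hne _) (hune 0))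
  -- the grafted determinant at scale D: det P y + ε (y/t⋆)^D u y
  have hgraft : ∀ (D : ℕ) (y : ℝ),
      (P y + (ε * (y / tstar) ^ D) • vecMulVec v v).det = (P y).det + ε * (y / tstar) ^ D * u y := by
    intro D y
    rw [det_add_smul_vecMulVec]
  -- (i) OLD points: the graft dies
  have hold : ∀ j : Fin (N + 1), ∀ᶠ D : ℕ in atTop,
      0 < (P (τ j) + (ε * (τ j / tstar) ^ D) • vecMulVec v v).det * (P (τ j)).det := by
    intro j
    have hr0 : 0 ≤ τ j / tstar := div_nonneg (hτpos j).le htpos.le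
    have hr1 : τ j / tstar < 1 := by
      rw [div_lt_one htpos]
      exact lt_of_le_of_lt (hτ.monotone (Fin.le_last j)) ht1
    have hpow : Tendsto (fun D : ℕ => (τ j / tstar) ^ D) atTop (𝓝 0) :=
      tendsto_pow_atTop_nhds_zero_of_lt_one hr0 hr1
    have hlim : Tendsto (fun D : ℕ => (P (τ j)).det + ε * (τ j / tstar) ^ D * u (τ j)) atTop
        (𝓝 ((P (τ j)).det)) := by
      have h := ((hpow.const_mul ε).mul_const (u (τ j))).const_add ((P (τ j)).det)
      simpa using h
    have hev := eventually_mul_pos_of_tendsto hlim (hne j)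
    refine hev.mono fun D hD => ?_
    rw [hgraft]; exact hD
  -- (ii) NEW points: after division by (σ j / t⋆)^D the old pencil dies
  have hnew : ∀ j : Fin (M + 1), ∀ᶠ D : ℕ in atTop,
      0 < (P (σ j) + (ε * (σ j / tstar) ^ D) • vecMulVec v v).det * (ε * u (σ j)) := by
    intro j
    have hr0 : 0 ≤ tstar / σ j := div_nonneg htpos.le (hσpos j).le
    have hr1 : tstar / σ j < 1 := by
      rw [div_lt_one (hσpos j)]
      exact lt_of_lt_of_le ht2 (hσ.monotone (Fin.zero_le j))
    have hpow : Tendsto (fun D : ℕ => (tstar / σ j) ^ D) atTop (𝓝 0) :=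
      tendsto_pow_atTop_nhds_zero_of_lt_one hr0 hr1
    have hlim : Tendsto (fun D : ℕ => (P (σ j)).det * (tstar / σ j) ^ D + ε * u (σ j)) atTop
        (𝓝 (ε * u (σ j))) := by
      have h := (hpow.const_mul ((P (σ j)).det)).add_const (ε * u (σ j))
      simpa using h
    have hL : ε * u (σ j) ≠ 0 := mul_ne_zero hεne (hune j)
    have hev := eventually_mul_pos_of_tendsto hlim hL
    refine hev.mono fun D hD => ?_
    have hq : 0 < (σ j / tstar) ^ D := pow_pos (div_pos (hσpos j) htpos) _
    have hident : (P (σ j) + (ε * (σ j / tstar) ^ D) • vecMulVec v v).det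
        = (σ j / tstar) ^ D * ((P (σ j)).det * (tstar / σ j) ^ D + ε * u (σ j)) := by
      rw [hgraft]
      have hst : (σ j / tstar) ^ D * (tstar / σ j) ^ D = 1 := by
        rw [← mul_pow, div_mul_div_comm, mul_comm (σ j) tstar, div_self (mul_ne_zero htpos.ne' (hσpos j).ne'),
          one_pow]
      calc (P (σ j)).det + ε * (σ j / tstar) ^ D * u (σ j)
          = (P (σ j)).det * ((σ j / tstar) ^ D * (tstar / σ j) ^ D) + ε * (σ j / tstar) ^ D * u (σ j) := by
            rw [hst, mul_one]
        _ = (σ j / tstar) ^ D * ((P (σ j)).det * (tstar / σ j) ^ D + ε * u (σ j)) := by ring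
    rw [hident, mul_assoc]
    exact mul_pos hq hD
  -- one `D` for everything, beyond all exponents
  have hbig : ∀ᶠ D : ℕ in atTop, ∀ l, d l < D := by
    refine eventually_all.mpr fun l => ?_
    exact eventually_gt_atTop (d l)
  obtain ⟨D, ⟨hDold, hDnew⟩, hDbig⟩ :=
    (((eventually_all.mpr hold).and (eventually_all.mpr hnew)).and hbig).exists
  refine ⟨D, ε * (tstar ^ D)⁻¹, hDbig, ?_⟩
  -- evaluation of the grafted pencil
  have heval : ∀ y : ℝ, ∑ l, y ^ (Fin.snoc d D : Fin (K + 1) → ℕ) l •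
      (Fin.snoc S ((ε * (tstar ^ D)⁻¹) • vecMulVec v v) : Fin (K + 1) → Matrix (Fin m) (Fin m) ℝ) l
        = P y + (ε * (y / tstar) ^ D) • vecMulVec v v := by
    intro y
    rw [snoc_eval, smul_smul, hP]
    congr 1
    rw [div_pow, div_eq_mul_inv]
    ring
  -- points and carriers
  intro τ'
  set s : Fin (N + M + 2) → ℝ := fun j =>
    if h : (j : ℕ) ≤ N then (P (τ ⟨j, Nat.lt_succ_of_le h⟩)).det else ε * u (σ ⟨(j : ℕ) - (N + 1), by omega⟩)
    with hs
  have hτ'_old : ∀ (j : Fin (N + M + 2)) (h : (j : ℕ) ≤ N), τ' j = τ ⟨j, Nat.lt_succ_of_le h⟩ :=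
    fun j h => by simp only [τ', dif_pos h]
  have hτ'_new : ∀ (j : Fin (N + M + 2)) (h : ¬ (j : ℕ) ≤ N), τ' j = σ ⟨(j : ℕ) - (N + 1), by omega⟩ :=
    fun j h => by simp only [τ', dif_neg h]
  have hs_old : ∀ (j : Fin (N + M + 2)) (h : (j : ℕ) ≤ N), s j = (P (τ ⟨j, Nat.lt_succ_of_le h⟩)).det :=
    fun j h => by simp only [hs, dif_pos h]
  have hs_new : ∀ (j : Fin (N + M + 2)) (h : ¬ (j : ℕ) ≤ N),
      s j = ε * u (σ ⟨(j : ℕ) - (N + 1), by omega⟩) :=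
    fun j h => by simp only [hs, dif_neg h]
  -- (F1) carriers carry the signs
  have hF1 : ∀ j : Fin (N + M + 2), 0 < (∑ l, τ' j ^ (Fin.snoc d D : Fin (K + 1) → ℕ) l •
      (Fin.snoc S ((ε * (tstar ^ D)⁻¹) • vecMulVec v v) : Fin (K + 1) → Matrix (Fin m) (Fin m) ℝ) l).det * s j := by
    intro j
    rw [heval]
    by_cases h : (j : ℕ) ≤ N
    · rw [hτ'_old j h, hs_old j h]; exact hDold _
    · rw [hτ'_new j h, hs_new j h]; exact hDnew _
  -- (F2) consecutive carriers have opposite signs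
  have hF2 : ∀ j : Fin (N + M + 1), s j.castSucc * s j.succ < 0 := by
    intro j
    have hc : ((Fin.castSucc j : Fin (N + M + 2)) : ℕ) = j := rfl
    have hsu : ((Fin.succ j : Fin (N + M + 2)) : ℕ) = j + 1 := rfl
    by_cases h1 : (j : ℕ) + 1 ≤ N
    · rw [hs_old _ (by rw [hc]; omega), hs_old _ (by rw [hsu]; exact h1)]
      have := halt ⟨j, by omega⟩
      convert this using 3 <;> simp [hP]
    · by_cases h2 : (j : ℕ) ≤ N
      · -- the junction `j = N`
        have hjN : (j : ℕ) = N := by omega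
        rw [hs_old _ (by rw [hc]; exact h2), hs_new _ (by rw [hsu]; omega)]
        have hlast : (⟨(Fin.castSucc j : ℕ), Nat.lt_succ_of_le (by rw [hc]; exact h2)⟩ : Fin (N + 1)) = Fin.last N :=
          Fin.ext (by simp [hjN])
        have hzero : (⟨(Fin.succ j : ℕ) - (N + 1), by rw [hsu]; omega⟩ : Fin (M + 1)) = 0 :=
          Fin.ext (by simp [hjN])
        rw [hlast, hzero, hε]
        have hx : (P (τ (Fin.last N))).det ≠ 0 := hne _
        have hy : u (σ 0) ≠ 0 := hune 0
        have hsq : 0 < ((P (τ (Fin.last N))).det * u (σ 0)) ^ 2 := by positivity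
        nlinarith [hsq]
      · -- inside the new block
        rw [hs_new _ (by rw [hc]; exact h2), hs_new _ (by rw [hsu]; omega)]
        have hidx : (⟨(Fin.succ j : ℕ) - (N + 1), by rw [hsu]; omega⟩ : Fin (M + 1))
            = Fin.succ ⟨(j : ℕ) - (N + 1), by omega⟩ := Fin.ext (by simp; omega)
        have hidx' : (⟨(Fin.castSucc j : ℕ) - (N + 1), by rw [hc]; omega⟩ : Fin (M + 1))
            = Fin.castSucc ⟨(j : ℕ) - (N + 1), by omega⟩ := Fin.ext (by simp)
        rw [hidx, hidx']
        have h := hualt ⟨(j : ℕ) - (N + 1), by omega⟩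
        have hε2 : 0 < ε * ε := mul_self_pos.mpr hεne
        have hrw : ε * u (σ (Fin.castSucc ⟨(j : ℕ) - (N + 1), by omega⟩)) *
            (ε * u (σ (Fin.succ ⟨(j : ℕ) - (N + 1), by omega⟩)))
            = (ε * ε) * (u (σ (Fin.castSucc ⟨(j : ℕ) - (N + 1), by omega⟩)) *
              u (σ (Fin.succ ⟨(j : ℕ) - (N + 1), by omega⟩))) := by ring
        rw [hrw]
        exact mul_neg_of_pos_of_neg hε2 h
  refine ⟨strictMono_glue τ σ hτ hσ hsep, ?_, ?_, ?_⟩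
  · intro j
    by_cases h : (j : ℕ) ≤ N
    · rw [hτ'_old j h]; exact hτpos _
    · rw [hτ'_new j h]; exact hσpos _
  · intro j h0
    have := hF1 j
    rw [h0, zero_mul] at this
    exact lt_irrefl _ this
  · intro j
    exact mul_neg_of_carriers (hF1 j.castSucc) (hF1 j.succ) (hF2 j)

/-- **Row form of the deep-end law**: under the hypotheses of `exists_alternating_rankOne_graft` (with symmetric letters), the census
row `¬ PosRootLawAt m (K+1) (N + M)` — i.e. `ζ_sym(m, K+1) ≥ N + M + 1`: the core's `N`, the junction, and the `M` far alternations of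
the adjugate form. [folklore] -/
theorem not_posRootLawAt_rankOne_graft {m K N M : ℕ} (d : Fin K → ℕ) (S : Fin K → Matrix (Fin m) (Fin m) ℝ)
    (hS : ∀ l, (S l).IsSymm)
    (τ : Fin (N + 1) → ℝ) (hτ : StrictMono τ) (hτpos : ∀ j, 0 < τ j)
    (hne : ∀ j, (∑ l, τ j ^ d l • S l).det ≠ 0)
    (halt : ∀ j : Fin N, (∑ l, τ j.castSucc ^ d l • S l).det * (∑ l, τ j.succ ^ d l • S l).det < 0)
    (v : Fin m → ℝ) (σ : Fin (M + 1) → ℝ) (hσ : StrictMono σ) (hsep : τ (Fin.last N) < σ 0)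
    (hune : ∀ j, v ⬝ᵥ ((∑ l, σ j ^ d l • S l).adjugate *ᵥ v) ≠ 0)
    (hualt : ∀ j : Fin M, (v ⬝ᵥ ((∑ l, σ j.castSucc ^ d l • S l).adjugate *ᵥ v)) *
      (v ⬝ᵥ ((∑ l, σ j.succ ^ d l • S l).adjugate *ᵥ v)) < 0) :
    ¬ PosRootLawAt m (K + 1) (N + M) := by
  obtain ⟨D, μ, _, hmono, hpos, _, halt'⟩ :=
    exists_alternating_rankOne_graft d S τ hτ hτpos hne halt v σ hσ hsep hune hualt
  have hS' : ∀ l, ((Fin.snoc S (μ • vecMulVec v v) : Fin (K + 1) → Matrix (Fin m) (Fin m) ℝ) l).IsSymm := by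
    intro l
    refine Fin.lastCases ?_ (fun i => ?_) l
    · simp only [Fin.snoc_last]
      exact (isSymm_vecMulVec_self v).smul μ
    · simp only [Fin.snoc_castSucc]
      exact hS i
  have h := not_posRootLawAt_of_alternating (by omega) (Fin.snoc d D) (Fin.snoc S (μ • vecMulVec v v)) hS' _ hmono hpos halt'
  simpa using h

end Summit.ValiantsHypothesis.ValiantsHypothesis.Theorems.LacunarySymmetroidMatrixDescartes.Census.DeepEnd
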